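import Literature.Probability.RandomPlanarGeometry.HexSAWStripSurfaceThresholdRate
import HarnessLib

/-!
# The contact-indexed arch cut in the strip: `α_{T,m+n-1} ≤ x_c⁻¹ · β_{T,m} · β_{T,n}`

[BBdGDCG14] = Beaton–Bousquet-Mélou–de Gier–Duminil-Copin–Guttmann, *The critical fugacity for surface adsorption of
self-avoiding walks on the honeycomb lattice is 1 + √2*, CMP 326 (2014), arXiv:1109.0358v5. In the strip `S_{T,L}` of
width `T` at the critical fugacity `x_c`, write `α_{T,L,m}` / `β_{T,L,m}` for the `x_c`-weight of the arches / bridges with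
exactly `m` top contacts (`stripAcoeffY` / `stripBcoeffY`) and `α_{T,m} = sup_L α_{T,L,m}`, `β_{T,m} = sup_L β_{T,L,m}`
(`stripAcoeff` / `stripBcoeff`, [BBdGDCG14, Corollary 8]).

**Main statement** (`stripArchContactCut_holds`). For every `T ≥ 1` and all `m, n ≥ 1`,
`α_{T,m+n-1} ≤ x_c⁻¹ · β_{T,m} · β_{T,n}`; in the binder shape
`∃ K : ℝ, 0 < K ∧ ∀ m n : ℕ, 1 ≤ m → 1 ≤ n → stripAcoeff T (m + n - 1) ≤ K * stripBcoeff T m * stripBcoeff T n`.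

**Proof** (the printed cutting idea of [BBdGDCG14, §4.5, eq. (20)] — "By looking at its last contact, one can
factor the arch into two bridges" — applied at the `m`-TH contact INSIDE ONE WIDTH, instead of at the last contact as
in print and in `HexSAWStripSurfaceArchCut`). An arch of `S_{T,L}` with `m+n-1` contacts has inner vertex list `l`
(from `O` to the exit vertex on level `0`, `archDom_spec`); let `j = nthContactIdx T m l` be the index of its `m`-th
contact (`nthContactIdx_spec`: the least `j` with `m` contacts in `l[0..j]`; then `l[j]` is a contact and `l[j..]`
carries `n` contacts). The head `l[0..j]` is a bridge of `S_{T,L}` with `m` contacts (`mcFst_mem_bridgeLists`); the tail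
`l[j..]`, REVERSED and translated horizontally by minus the abscissa of the exit vertex, is a bridge of `S_{T,2L}` with
`n` contacts (`mcSnd_mem_bridgeLists`: it starts at `O`, ends at the translate of the contact `l[j]` on the top level,
and a translation by at most `L` keeps it in the box of half-width `2L`). The contact `l[j]` belongs to BOTH pieces, so
the lengths add up to `|l| + 1` (`mcPair_len`) — whence the factor `x_c⁻¹` — and the pair of pieces determines the arch
(`mcPair_injOn`: the index `j` is read off the first piece, the translation off the two images of `l[j]`). Summing the
weights over the injective map (`sum_le_mul_sum_mul_sum_of_injOn`) gives the finite-box inequality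
`α_{T,L,m+n-1} ≤ x_c⁻¹ β_{T,L,m} β_{T,2L,n}` (`stripAcoeffY_contactCut`), and `L → ∞` (`tendsto_stripAcoeffY`,
`β_{T,L,·} ≤ β_{T,·}`) gives the statement (`stripAcoeff_contactCut_of_box`).

**Not claimed.** Nothing about `m = 0` or `n = 0` (arches / bridges without contacts), no equality case, no statement
across widths (that is `HexSAWStripSurfaceArchCut.stripArchCut`).

**Editions and consumers.** ed.1 (pub-sawmu family A, a-idea-1 g27, car 31). The main statement is, character for
character, the hypothesis `hC` of `HexSAWStripSurfaceThresholdBootstrap.not_tendsto_zero_stripBcoeff_mul_stripYT_pow` /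
`exists_linear_io_partialSum_stripBcoeff_stripYT` (car 29, ed.4); together with `HexSAWStripSurfaceCoeffIdentity.
stripCoeffIdentity_holds` (car 30, hypothesis `hE`) it makes those two statements unconditional for every `T ≥ 1`:
`β_{T,m} y_T^m ↛ 0` and `Σ_{m ≤ M} β_{T,m} y_T^m ≥ s·M` along a subsequence.
-/

namespace Literature.Probability.RandomPlanarGeometry.SAW.HV

open Finset Filter Topology

noncomputable section

variable {T : ℕ}

/-! ## The `m`-th contact cutting map (definitions; the contacts of `S_T` live on level `2T - 1`) -/

/-- The number of top contacts (level `2T-1`) among the first `i` inner vertices.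
[cite: BeatonBousquetMelouDeGierDuminilCopinGuttmann2014, §4.5 eq. (20) (arXiv v5 p. 15: an arch cut at a surface contact into two bridges); lane: the cut at the m-th contact inside one width] -/
def contactCount (T : ℕ) (l : List HV) (i : ℕ) : ℕ := ((l.take i).filter fun v => lev v = 2 * (T : ℤ) - 1).length

open Classical in
/-- The index of the `m`-th top contact (`m ≥ 1`): the least `j` with `m` contacts among `l[0..j]`
(junk `0` if there are fewer than `m`). [cite: BeatonBousquetMelouDeGierDuminilCopinGuttmann2014, §4.5 eq. (20) (arXiv v5 p. 15: an arch cut at a surface contact into two bridges); lane: the cut at the m-th contact inside one width] -/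
def nthContactIdx (T m : ℕ) (l : List HV) : ℕ :=
  if h : ∃ i, contactCount T l (i + 1) = m then Nat.find h else 0

/-- First piece `[O, …, v]`, `v` = the `m`-th contact. [cite: BeatonBousquetMelouDeGierDuminilCopinGuttmann2014, §4.5 eq. (20) (arXiv v5 p. 15: an arch cut at a surface contact into two bridges); lane: the cut at the m-th contact inside one width] -/
def mcFst (T m : ℕ) (l : List HV) : List HV := l.take (nthContactIdx T m l + 1)

/-- Reversed second piece `[exit, …, v]` (the contact `v` belongs to BOTH pieces). [cite: BeatonBousquetMelouDeGierDuminilCopinGuttmann2014, §4.5 eq. (20) (arXiv v5 p. 15: an arch cut at a surface contact into two bridges); lane: the cut at the m-th contact inside one width] -/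
def mcRev (T m : ℕ) (l : List HV) : List HV := (l.drop (nthContactIdx T m l)).reverse

/-- Second piece, translated horizontally to start at `O`. [cite: BeatonBousquetMelouDeGierDuminilCopinGuttmann2014, §4.5 eq. (20) (arXiv v5 p. 15: an arch cut at a surface contact into two bridges); lane: the cut at the m-th contact inside one width] -/
def mcSnd (T m : ℕ) (l : List HV) : List HV :=
  (mcRev T m l).map (shift (-((mcRev T m l).headD hvOrigin).1) 0)

/-- Close an inner list ending on the top level into an `a → β` walk. [cite: DuminilCopinSmirnov2012, §3 (bridges a → β)] -/
def closeBeta (l : List HV) : List HV := wOut :: (l ++ [upOf (l.getLastD hvOrigin)])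

/-- The cutting map on walks: arch ↦ (bridge₁ of `S_{T,L}`, bridge₂ of `S_{T,2L}`). [cite: BeatonBousquetMelouDeGierDuminilCopinGuttmann2014, §4.5 eq. (20) (arXiv v5 p. 15: an arch cut at a surface contact into two bridges); lane: the cut at the m-th contact inside one width] -/
def mcPair (T m : ℕ) (P : List HV) : List HV × List HV :=
  (closeBeta (mcFst T m (inner P)), closeBeta (mcSnd T m (inner P)))

/-- The arches of `S_{T,L}` with exactly `k` top contacts (the index set of `stripAcoeffY T L k`). [cite: BeatonBousquetMelouDeGierDuminilCopinGuttmann2014, §2 eq. (10) (arXiv v5 p. 6: the box generating functions)] -/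
def archDom (T L k : ℕ) : Finset (List HV) :=
  ((midWalks (stripV T L)).filter (fun P => IsAlphaDart (finalDart P))).filter (fun P => surfContacts T P = k)

/-- The bridges of `S_{T,L}` with exactly `k` top contacts (the index set of `stripBcoeffY T L k`). [cite: BeatonBousquetMelouDeGierDuminilCopinGuttmann2014, §2 eq. (10) (arXiv v5 p. 6: the box generating functions)] -/
def betaDom (T L k : ℕ) : Finset (List HV) :=
  ((midWalks (stripV T L)).filter (fun P => IsBetaDart T (finalDart P))).filter (fun P => surfContacts T P = k)

/-- `α_{T,L,k}` as a sum over `archDom`. [cite: BeatonBousquetMelouDeGierDuminilCopinGuttmann2014, §2 eq. (10) (arXiv v5 p. 6: the box generating functions)] -/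
theorem stripAcoeffY_eq_sum_archDom (T L k : ℕ) :
    stripAcoeffY T L k = ∑ P ∈ archDom T L k, hexCriticalFugacity ^ mwLen P := rfl

/-- `β_{T,L,k}` as a sum over `betaDom`. [cite: BeatonBousquetMelouDeGierDuminilCopinGuttmann2014, §2 eq. (10) (arXiv v5 p. 6: the box generating functions)] -/
theorem stripBcoeffY_eq_sum_betaDom (T L k : ℕ) :
    stripBcoeffY T L k = ∑ P ∈ betaDom T L k, hexCriticalFugacity ^ mwLen P := rfl

/-! ## Anatomy of an arch with `k` contacts; closing a bridge list into a `β`-walk -/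

/-- Anatomy of an arch of `S_{T,L}` (pattern of `cutDom_spec`): inner list `l ≠ []` from `O`, exit straight below
`l.last`, which lies on level `0`; the contact count is the filter-length of `l`. [cite: DuminilCopinSmirnov2012, §3 (arches a → α)] -/
theorem archDom_spec {L k : ℕ} {P : List HV} (hP : P ∈ archDom T L k) :
    ∃ (l : List HV) (hl : l ≠ []),
      P = wOut :: (l ++ [((l.getLast hl).1, -1, true)]) ∧ l.IsChain hvGraph.Adj ∧
      l.head? = some hvOrigin ∧ l.Nodup ∧ (∀ x ∈ l, x ∈ stripV T L) ∧
      (l.getLast hl).2.1 = 0 ∧ (l.getLast hl).2.2 = false ∧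
      (l.filter fun v => lev v = 2 * (T : ℤ) - 1).length = k := by
  rw [archDom, mem_filter, mem_filter, mem_midWalks_iff] at hP
  obtain ⟨⟨hP, hα⟩, hk⟩ := hP
  rcases hP.trivial_or_exists with rfl | ⟨l, u, hl, rfl⟩
  · rw [finalDart_trivial] at hα
    obtain ⟨h1, -, -⟩ := hα
    simp [wOut] at h1
  rw [finalDart_cons_append hl] at hα
  obtain ⟨h0, hf, hu⟩ := hα
  dsimp only at h0 hf hu
  obtain ⟨hc, hh, -, hV, hnd, -⟩ := (isMidWalk_cons_append_iff _ hl _).1 hP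
  refine ⟨l, hl, by rw [hu], hc, hh, hnd, hV, h0, hf, ?_⟩
  rwa [surfContacts_cons_append] at hk

/-- Closing a bridge list `l ∈ bridgeLists T L` with `k` contacts gives a member of `betaDom T L k` of length `|l|`.
[cite: DuminilCopinSmirnov2012, §3 (bridges a → β)] -/
theorem closeBeta_mem_betaDom (hT : 1 ≤ T) {L k : ℕ} {l : List HV} (hB : l ∈ bridgeLists T L)
    (hk : (l.filter fun v => lev v = 2 * (T : ℤ) - 1).length = k) :
    closeBeta l ∈ betaDom T L k ∧ mwLen (closeBeta l) = l.length := by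
  rw [bridgeLists, mem_image] at hB
  obtain ⟨P, hP, hPl⟩ := hB
  have hP' := hP
  rw [mem_filter, mem_midWalks_iff] at hP'
  obtain ⟨l', hl', hPeq, -⟩ := eq_of_isBetaDart hT hP'.1 hP'.2
  have hll : l' = l := by rw [← hPl, hPeq, inner_cons_append]
  subst hll
  have hcb : closeBeta l' = P := by
    rw [hPeq, closeBeta, List.getLastD_eq_getLast?, List.getLast?_eq_some_getLast hl', Option.getD_some]
  rw [hcb, betaDom, mem_filter]
  refine ⟨⟨hP, ?_⟩, ?_⟩
  · rw [hPeq, surfContacts_cons_append]; exact hk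
  · rw [hPeq, mwLen_cons_append]

/-! ## The `m`-th contact index -/

/-- One more vertex adds at most one contact. [cite: BeatonBousquetMelouDeGierDuminilCopinGuttmann2014, §4.5 eq. (20) (arXiv v5 p. 15: an arch cut at a surface contact into two bridges); lane: the cut at the m-th contact inside one width] -/
theorem contactCount_succ_le (T : ℕ) (l : List HV) (i : ℕ) : contactCount T l i ≤ contactCount T l (i + 1) ∧ contactCount T l (i + 1) ≤ contactCount T l i + 1 := by
  unfold contactCount
  rw [List.take_add_one, List.filter_append, List.length_append]
  refine ⟨Nat.le_add_right _ _, Nat.add_le_add_left ?_ _⟩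
  exact (List.length_filter_le _ _).trans (by cases l[i]? <;> simp)

/-- No vertices, no contacts. [cite: BeatonBousquetMelouDeGierDuminilCopinGuttmann2014, §4.5 eq. (20) (arXiv v5 p. 15: an arch cut at a surface contact into two bridges); lane: the cut at the m-th contact inside one width] -/
theorem contactCount_zero (T : ℕ) (l : List HV) : contactCount T l 0 = 0 := by simp [contactCount]

/-- Beyond the end the count is the total contact number. [cite: BeatonBousquetMelouDeGierDuminilCopinGuttmann2014, §4.5 eq. (20) (arXiv v5 p. 15: an arch cut at a surface contact into two bridges); lane: the cut at the m-th contact inside one width] -/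
theorem contactCount_of_length_le (T : ℕ) {l : List HV} {i : ℕ} (h : l.length ≤ i) :
    contactCount T l i = (l.filter fun v => lev v = 2 * (T : ℤ) - 1).length := by
  rw [contactCount, List.take_of_length_le h]

/-- Discrete intermediate values for a counting function with unit steps. [cite: BeatonBousquetMelouDeGierDuminilCopinGuttmann2014, §4.5 eq. (20) (arXiv v5 p. 15: an arch cut at a surface contact into two bridges); lane: the cut at the m-th contact inside one width] -/
theorem exists_contactCount_eq (T : ℕ) (l : List HV) {m : ℕ} (hm : 1 ≤ m) :
    ∀ N : ℕ, m ≤ contactCount T l N → ∃ i, i < N ∧ contactCount T l (i + 1) = m := by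
  intro N
  induction N with
  | zero => intro h; rw [contactCount_zero] at h; omega
  | succ N ih =>
    intro h
    by_cases h' : m ≤ contactCount T l N
    · obtain ⟨i, hi, he⟩ := ih h'
      exact ⟨i, by omega, he⟩
    · have := contactCount_succ_le T l N
      exact ⟨N, N.lt_succ_self, by omega⟩

/-- Specification of the `m`-th contact index when `l` carries `m + n - 1 ≥ m` contacts:
it is a valid index, exactly `m` contacts lie in `l[0..j]` and exactly `m - 1` in `l[0..j-1]` (so `l[j]` is a contact
and the tail `l[j..]` carries `n` contacts). [cite: BeatonBousquetMelouDeGierDuminilCopinGuttmann2014, §4.5 eq. (20) (arXiv v5 p. 15: an arch cut at a surface contact into two bridges); lane: the cut at the m-th contact inside one width] -/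
theorem nthContactIdx_spec {l : List HV} {m n : ℕ} (hm : 1 ≤ m) (hn : 1 ≤ n)
    (hk : (l.filter fun v => lev v = 2 * (T : ℤ) - 1).length = m + n - 1) :
    nthContactIdx T m l < l.length ∧ contactCount T l (nthContactIdx T m l + 1) = m ∧
      contactCount T l (nthContactIdx T m l) = m - 1 := by
  classical
  have hex : ∃ i, contactCount T l (i + 1) = m := by
    obtain ⟨i, -, hi⟩ := exists_contactCount_eq T l hm l.length (by rw [contactCount_of_length_le T le_rfl, hk]; omega)
    exact ⟨i, hi⟩
  have hj : nthContactIdx T m l = Nat.find hex := by rw [nthContactIdx, dif_pos hex]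
  set j := nthContactIdx T m l with hjdef
  have hspec : contactCount T l (j + 1) = m := by rw [hj]; exact Nat.find_spec hex
  have hmin : ∀ i, i < j → contactCount T l (i + 1) ≠ m := fun i hi => by
    rw [hj] at hi; exact Nat.find_min hex hi
  have hprev : contactCount T l j = m - 1 := by
    rcases Nat.eq_zero_or_eq_succ_pred j with h0 | hs
    · have := contactCount_succ_le T l 0
      rw [h0] at hspec ⊢
      rw [contactCount_zero] at this ⊢
      omega
    · have h1 := hmin (j - 1) (by omega)
      have h2 := contactCount_succ_le T l (j - 1)
      have h3 := contactCount_succ_le T l j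
      rw [show j - 1 + 1 = j by omega] at h1 h2
      omega
  refine ⟨?_, hspec, hprev⟩
  by_contra hge
  rw [not_lt] at hge
  rw [contactCount_of_length_le T hge, hk] at hprev
  omega

/-- The vertex at the `m`-th contact index is a contact. [cite: BeatonBousquetMelouDeGierDuminilCopinGuttmann2014, §4.5 eq. (20) (arXiv v5 p. 15: an arch cut at a surface contact into two bridges); lane: the cut at the m-th contact inside one width] -/
theorem lev_getElem_nthContactIdx {l : List HV} {m n : ℕ} (hm : 1 ≤ m) (hn : 1 ≤ n)
    (hk : (l.filter fun v => lev v = 2 * (T : ℤ) - 1).length = m + n - 1)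
    (h : nthContactIdx T m l < l.length) : lev l[nthContactIdx T m l] = 2 * (T : ℤ) - 1 := by
  obtain ⟨-, h1, h2⟩ := nthContactIdx_spec hm hn hk
  unfold contactCount at h1 h2
  rw [List.take_add_one, List.filter_append, List.length_append, List.getElem?_eq_getElem h] at h1
  by_contra hne
  simp [hne] at h1
  omega

/-- The tail from the `m`-th contact on carries `n` contacts. [cite: BeatonBousquetMelouDeGierDuminilCopinGuttmann2014, §4.5 eq. (20) (arXiv v5 p. 15: an arch cut at a surface contact into two bridges); lane: the cut at the m-th contact inside one width] -/
theorem length_filter_drop_nthContactIdx {l : List HV} {m n : ℕ} (hm : 1 ≤ m) (hn : 1 ≤ n)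
    (hk : (l.filter fun v => lev v = 2 * (T : ℤ) - 1).length = m + n - 1) :
    ((l.drop (nthContactIdx T m l)).filter fun v => lev v = 2 * (T : ℤ) - 1).length = n := by
  obtain ⟨-, -, h2⟩ := nthContactIdx_spec hm hn hk
  unfold contactCount at h2
  have := congrArg (fun l' => (l'.filter fun v => lev v = 2 * (T : ℤ) - 1).length)
    (List.take_append_drop (nthContactIdx T m l) l)
  simp only [List.filter_append, List.length_append] at this
  omega

/-- The head piece `l[0..j]` carries `m` contacts. [cite: BeatonBousquetMelouDeGierDuminilCopinGuttmann2014, §4.5 eq. (20) (arXiv v5 p. 15: an arch cut at a surface contact into two bridges); lane: the cut at the m-th contact inside one width] -/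
theorem length_filter_mcFst {l : List HV} {m n : ℕ} (hm : 1 ≤ m) (hn : 1 ≤ n)
    (hk : (l.filter fun v => lev v = 2 * (T : ℤ) - 1).length = m + n - 1) :
    ((mcFst T m l).filter fun v => lev v = 2 * (T : ℤ) - 1).length = m :=
  (nthContactIdx_spec hm hn hk).2.1

/-! ## The cutting map: membership, lengths, injectivity (templates `lcFst_mem`, `lcSnd_mem`, `length_eq_lc`, `lc_injOn`) -/

/-- The first piece is a bridge of `S_{T,L}`. [cite: BeatonBousquetMelouDeGierDuminilCopinGuttmann2014, §4.5 eq. (20) (arXiv v5 p. 15: an arch cut at a surface contact into two bridges); lane: the cut at the m-th contact inside one width] -/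
theorem mcFst_mem_bridgeLists (hT : 1 ≤ T) {L m n : ℕ} (hm : 1 ≤ m) (hn : 1 ≤ n) {P : List HV}
    (hP : P ∈ archDom T L (m + n - 1)) : mcFst T m (inner P) ∈ bridgeLists T L := by
  obtain ⟨l, hl, rfl, hc, hh, hnd, hV, -, -, hk⟩ := archDom_spec hP
  rw [inner_cons_append]
  obtain ⟨hj, -, -⟩ := nthContactIdx_spec hm hn hk
  have hlev := lev_getElem_nthContactIdx hm hn hk hj
  rw [mem_bridgeLists_iff hT, mcFst]
  have hne : l.take (nthContactIdx T m l + 1) ≠ [] := by simp [hl]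
  refine ⟨hc.take _, by rw [List.head?_take]; simpa using hh, hnd.sublist (List.take_sublist _ _),
    fun x hx => hV x (List.mem_of_mem_take hx), hne, ?_⟩
  have hlt : (l.take (nthContactIdx T m l + 1)).getLast hne = l[nthContactIdx T m l] := by
    simp [List.getLast_eq_getElem, List.getElem_take,
      Nat.min_eq_left (show nthContactIdx T m l + 1 ≤ l.length by omega)]
  rw [hlt, hlev]

/-- The second piece is a bridge of `S_{T,2L}` with `n` contacts (reversal and horizontal translation preserve
adjacency, self-avoidance and levels; a translation by at most `L` stays in the box of half-width `2L`). [cite: BeatonBousquetMelouDeGierDuminilCopinGuttmann2014, §4.5 eq. (20) (arXiv v5 p. 15: an arch cut at a surface contact into two bridges); lane: the cut at the m-th contact inside one width] -/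
theorem mcSnd_mem_bridgeLists (hT : 1 ≤ T) {L m n : ℕ} (hm : 1 ≤ m) (hn : 1 ≤ n) {P : List HV}
    (hP : P ∈ archDom T L (m + n - 1)) :
    mcSnd T m (inner P) ∈ bridgeLists T (2 * L) ∧
      ((mcSnd T m (inner P)).filter fun v => lev v = 2 * (T : ℤ) - 1).length = n := by
  obtain ⟨l, hl, rfl, hc, hh, hnd, hV, h0, hf, hk⟩ := archDom_spec hP
  rw [inner_cons_append]
  obtain ⟨hj, -, -⟩ := nthContactIdx_spec hm hn hk
  have hlev := lev_getElem_nthContactIdx hm hn hk hj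
  have hdropn := length_filter_drop_nthContactIdx hm hn hk
  have hr : mcRev T m l ≠ [] := by simp [mcRev]; omega
  have hhead : (mcRev T m l).head hr = l.getLast hl := by simp [mcRev]
  have hlast : (mcRev T m l).getLast hr = l[nthContactIdx T m l] := by simp [mcRev]
  set a := ((mcRev T m l).headD hvOrigin).1 with ha
  have ha' : a = (l.getLast hl).1 := by
    rw [ha, List.headD_eq_head?_getD, List.head?_eq_some_head hr, Option.getD_some, hhead]
  have hzV := hV _ (List.getLast_mem hl)
  rw [mem_stripV_iff] at hzV
  have habs : -(L : ℤ) ≤ a ∧ a ≤ L := by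
    rw [ha']; simp only [h0, bit, hf] at hzV; constructor <;> simp at hzV <;> omega
  refine ⟨?_, ?_⟩
  · rw [mcSnd, mem_bridgeLists_iff hT, ← ha]
    refine ⟨?_, ?_, ?_, ?_, by simpa using hr, ?_⟩
    · rw [List.isChain_map]
      have h1 : (mcRev T m l).IsChain (fun x y => hvGraph.Adj x y) := by
        rw [mcRev, List.isChain_reverse]
        exact (hc.drop _).imp fun x y (h : hvGraph.Adj x y) => h.symm
      exact h1.imp fun x y h => (shift (-a) 0).map_rel_iff.2 h
    · rw [List.head?_map, List.head?_eq_some_head hr, hhead, Option.map_some, shift_apply]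
      simp only [Option.some.injEq, hvOrigin, ha', h0, hf, add_zero]
      simp
    · exact (List.nodup_reverse.2 (hnd.sublist (List.drop_sublist _ _))).map (shift (-a) 0).injective
    · intro y hy
      rw [List.mem_map] at hy
      obtain ⟨v, hv, rfl⟩ := hy
      have hv' : v ∈ l := List.mem_of_mem_drop (by rwa [mcRev, List.mem_reverse] at hv)
      have hmem := hV _ hv'
      rw [mem_stripV_iff] at hmem ⊢
      rcases v with ⟨p, q, b⟩
      cases b <;> simp [bit, lev] at hmem ⊢ <;> omega
    · rw [List.getLast_map, hlast, lev_shift_zero, hlev]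
  · simp only [mcSnd, List.filter_map, List.length_map, Function.comp_def, lev_shift_zero]
    rw [mcRev, List.filter_reverse, List.length_reverse, hdropn]

/-- `closeBeta` is injective. [cite: DuminilCopinSmirnov2012, §3 (bridges a → β)] -/
theorem closeBeta_injective {l₁ l₂ : List HV} (h : closeBeta l₁ = closeBeta l₂) : l₁ = l₂ := by
  have := congrArg (fun P : List HV => P.tail.dropLast) h
  simpa [closeBeta] using this

/-- First piece: a member of `betaDom T L m`. [cite: BeatonBousquetMelouDeGierDuminilCopinGuttmann2014, §4.5 eq. (20) (arXiv v5 p. 15: an arch cut at a surface contact into two bridges); lane: the cut at the m-th contact inside one width] -/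
theorem mcPair_fst_mem (hT : 1 ≤ T) {L m n : ℕ} (hm : 1 ≤ m) (hn : 1 ≤ n) {P : List HV}
    (hP : P ∈ archDom T L (m + n - 1)) : (mcPair T m P).1 ∈ betaDom T L m := by
  have hB := mcFst_mem_bridgeLists hT hm hn hP
  obtain ⟨l, hl, hPeq, -, -, -, -, -, -, hk⟩ := archDom_spec hP
  have hin : inner P = l := by rw [hPeq, inner_cons_append]
  rw [hin] at hB
  have := (closeBeta_mem_betaDom hT hB (length_filter_mcFst hm hn hk)).1
  show closeBeta (mcFst T m (inner P)) ∈ _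
  rwa [hin]

/-- Second piece: a member of `betaDom T (2L) n`. [cite: BeatonBousquetMelouDeGierDuminilCopinGuttmann2014, §4.5 eq. (20) (arXiv v5 p. 15: an arch cut at a surface contact into two bridges); lane: the cut at the m-th contact inside one width] -/
theorem mcPair_snd_mem (hT : 1 ≤ T) {L m n : ℕ} (hm : 1 ≤ m) (hn : 1 ≤ n) {P : List HV}
    (hP : P ∈ archDom T L (m + n - 1)) : (mcPair T m P).2 ∈ betaDom T (2 * L) n := by
  obtain ⟨hB, hn'⟩ := mcSnd_mem_bridgeLists hT hm hn hP
  exact (closeBeta_mem_betaDom hT hB hn').1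

/-- Lengths: the contact `v` is counted in both pieces, so the lengths add up to `|arch| + 1` (the factor `x_c⁻¹`).
[cite: BeatonBousquetMelouDeGierDuminilCopinGuttmann2014, §4.5 eq. (20) (arXiv v5 p. 15: an arch cut at a surface contact into two bridges); lane: the cut at the m-th contact inside one width] -/
theorem mcPair_len {L m n : ℕ} (hm : 1 ≤ m) (hn : 1 ≤ n) {P : List HV}
    (hP : P ∈ archDom T L (m + n - 1)) :
    mwLen (mcPair T m P).1 + mwLen (mcPair T m P).2 = mwLen P + 1 := by
  obtain ⟨l, hl, hPeq, -, -, -, -, -, -, hk⟩ := archDom_spec hP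
  obtain ⟨hj, -, -⟩ := nthContactIdx_spec hm hn hk
  have hin : inner P = l := by rw [hPeq, inner_cons_append]
  have e1 : mwLen (mcPair T m P).1 = (mcFst T m l).length := by
    show mwLen (closeBeta (mcFst T m (inner P))) = _
    rw [hin, closeBeta, mwLen_cons_append]
  have e2 : mwLen (mcPair T m P).2 = (mcSnd T m l).length := by
    show mwLen (closeBeta (mcSnd T m (inner P))) = _
    rw [hin, closeBeta, mwLen_cons_append]
  have e3 : mwLen P = l.length := by rw [hPeq, mwLen_cons_append]
  rw [e1, e2, e3, mcFst, mcSnd, List.length_map, mcRev, List.length_reverse, List.length_take, List.length_drop,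
    Nat.min_eq_left (by omega)]
  omega

/-- Injectivity of the cutting map for fixed `m`: the index is read off the first piece, the translation off the two
images of the shared contact, and the arch is `head ++ tail`. [cite: BeatonBousquetMelouDeGierDuminilCopinGuttmann2014, §4.5 eq. (20) (arXiv v5 p. 15: an arch cut at a surface contact into two bridges); lane: the cut at the m-th contact inside one width] -/
theorem mcPair_injOn {L m n : ℕ} (hm : 1 ≤ m) (hn : 1 ≤ n) :
    Set.InjOn (mcPair T m) (archDom T L (m + n - 1) : Set (List HV)) := by
  intro P hP P' hP' h
  have h1 : mcFst T m (inner P) = mcFst T m (inner P') := closeBeta_injective (congrArg Prod.fst h)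
  have h2 : mcSnd T m (inner P) = mcSnd T m (inner P') := closeBeta_injective (congrArg Prod.snd h)
  obtain ⟨l, hl, hPeq, -, -, -, -, -, -, hk⟩ := archDom_spec (Finset.mem_coe.1 hP)
  obtain ⟨l', hl', hPeq', -, -, -, -, -, -, hk'⟩ := archDom_spec (Finset.mem_coe.1 hP')
  have hin : inner P = l := by rw [hPeq, inner_cons_append]
  have hin' : inner P' = l' := by rw [hPeq', inner_cons_append]
  rw [hin, hin'] at h1 h2
  obtain ⟨hj, -, -⟩ := nthContactIdx_spec hm hn hk
  obtain ⟨hj', -, -⟩ := nthContactIdx_spec hm hn hk'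
  suffices hll : l = l' by subst hll; exact hPeq.trans hPeq'.symm
  rw [mcFst, mcFst] at h1
  have hjj : nthContactIdx T m l = nthContactIdx T m l' := by
    have := congrArg List.length h1
    simp only [List.length_take] at this
    omega
  have hv : l[nthContactIdx T m l] = l'[nthContactIdx T m l'] := by
    have e1 : (l.take (nthContactIdx T m l + 1))[nthContactIdx T m l]? = l[nthContactIdx T m l]? :=
      List.getElem?_take_of_lt (by omega)
    have e2 : (l'.take (nthContactIdx T m l' + 1))[nthContactIdx T m l]? = l'[nthContactIdx T m l]? :=
      List.getElem?_take_of_lt (by omega)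
    rw [h1] at e1
    have e := e1.symm.trans e2
    have e' : l'[nthContactIdx T m l]? = l'[nthContactIdx T m l']? := by rw [hjj]
    rw [e', List.getElem?_eq_getElem hj, List.getElem?_eq_getElem hj', Option.some_inj] at e
    exact e
  have hr : mcRev T m l ≠ [] := by simp [mcRev]; omega
  have hr' : mcRev T m l' ≠ [] := by simp [mcRev]; omega
  have hlast : (mcRev T m l).getLast hr = l[nthContactIdx T m l] := by simp [mcRev]
  have hlast' : (mcRev T m l').getLast hr' = l'[nthContactIdx T m l'] := by simp [mcRev]
  have ha : ((mcRev T m l).headD hvOrigin).1 = ((mcRev T m l').headD hvOrigin).1 := by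
    have := congrArg List.getLast? h2
    rw [mcSnd, mcSnd, List.getLast?_map, List.getLast?_map, List.getLast?_eq_some_getLast hr,
      List.getLast?_eq_some_getLast hr', Option.map_some, Option.map_some, Option.some_inj,
      hlast, hlast', hv] at this
    have := congrArg Prod.fst this
    simp only [shift_apply] at this
    linarith
  rw [mcSnd, mcSnd, ha] at h2
  have h3 : mcRev T m l = mcRev T m l' := (List.map_injective_iff.2 (RelIso.injective _)) h2
  rw [mcRev, mcRev, List.reverse_inj] at h3
  have htake : l.take (nthContactIdx T m l) = l'.take (nthContactIdx T m l') := by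
    have := congrArg (List.take (nthContactIdx T m l)) h1
    rw [List.take_take, List.take_take, Nat.min_eq_left (by omega), Nat.min_eq_left (by omega)] at this
    rw [this, hjj]
  calc l = l.take (nthContactIdx T m l) ++ l.drop (nthContactIdx T m l) := (List.take_append_drop _ _).symm
    _ = l'.take (nthContactIdx T m l') ++ l'.drop (nthContactIdx T m l') := by rw [htake, h3]
    _ = l' := List.take_append_drop _ _

/-! ## The weighted-injection inequality -/

/-- Weighted injection bound: if `f` maps `s` injectively into `t₁ × t₂` and `w a ≤ K w₁(f a)₁ w₂(f a)₂` with
non-negative weights, then `Σ_s w ≤ K (Σ_{t₁} w₁)(Σ_{t₂} w₂)`. [cite: BeatonBousquetMelouDeGierDuminilCopinGuttmann2014, §4.5 eq. (20) (arXiv v5 p. 15: an arch cut at a surface contact into two bridges); lane: the cut at the m-th contact inside one width] -/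
theorem sum_le_mul_sum_mul_sum_of_injOn {ι κ : Type*} [DecidableEq κ] {s : Finset ι} {t₁ t₂ : Finset κ}
    (f : ι → κ × κ) (hf : Set.InjOn f s) (h₁ : ∀ a ∈ s, (f a).1 ∈ t₁) (h₂ : ∀ a ∈ s, (f a).2 ∈ t₂)
    {w : ι → ℝ} {w₁ w₂ : κ → ℝ} {K : ℝ} (hK : 0 ≤ K) (hw₁ : ∀ b ∈ t₁, 0 ≤ w₁ b) (hw₂ : ∀ c ∈ t₂, 0 ≤ w₂ c)
    (hw : ∀ a ∈ s, w a ≤ K * w₁ (f a).1 * w₂ (f a).2) :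
    ∑ a ∈ s, w a ≤ K * (∑ b ∈ t₁, w₁ b) * (∑ c ∈ t₂, w₂ c) := by
  calc ∑ a ∈ s, w a ≤ ∑ a ∈ s, K * w₁ (f a).1 * w₂ (f a).2 := sum_le_sum hw
    _ = ∑ p ∈ s.image f, K * w₁ p.1 * w₂ p.2 := by
        rw [sum_image]
        exact fun a ha b hb h => hf ha hb h
    _ ≤ ∑ p ∈ t₁ ×ˢ t₂, K * w₁ p.1 * w₂ p.2 := by
        refine sum_le_sum_of_subset_of_nonneg ?_ ?_
        · intro p hp
          obtain ⟨a, ha, rfl⟩ := mem_image.1 hp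
          exact mem_product.2 ⟨h₁ a ha, h₂ a ha⟩
        · intro p hp _
          obtain ⟨hp₁, hp₂⟩ := mem_product.1 hp
          exact mul_nonneg (mul_nonneg hK (hw₁ _ hp₁)) (hw₂ _ hp₂)
    _ = K * (∑ b ∈ t₁, w₁ b) * (∑ c ∈ t₂, w₂ c) := by
        rw [sum_product, mul_assoc, sum_mul_sum]
        rw [mul_sum]
        refine sum_congr rfl fun b _ => ?_
        rw [mul_sum]
        refine sum_congr rfl fun c _ => ?_
        ring

/-! ## The finite-box contact cut -/

/-- **Finite-box contact cut**: `α_{T,L,m+n-1} ≤ x_c⁻¹ · β_{T,L,m} · β_{T,2L,n}` (`m, n ≥ 1`).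
[cite: BeatonBousquetMelouDeGierDuminilCopinGuttmann2014, §4.5 eq. (20) (arXiv v5 p. 15: an arch cut at a surface contact into two bridges); lane: the cut at the m-th contact inside one width] -/
theorem stripAcoeffY_contactCut (hT : 1 ≤ T) (L : ℕ) {m n : ℕ} (hm : 1 ≤ m) (hn : 1 ≤ n) :
    stripAcoeffY T L (m + n - 1) ≤
      hexCriticalFugacity⁻¹ * stripBcoeffY T L m * stripBcoeffY T (2 * L) n := by
  classical
  have hx := hexCriticalFugacity_pos_lt_one.1
  rw [stripAcoeffY_eq_sum_archDom, stripBcoeffY_eq_sum_betaDom, stripBcoeffY_eq_sum_betaDom]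
  refine sum_le_mul_sum_mul_sum_of_injOn (mcPair T m) (mcPair_injOn hm hn)
    (fun P hP => mcPair_fst_mem hT hm hn hP) (fun P hP => mcPair_snd_mem hT hm hn hP) (inv_pos.2 hx).le
    (fun _ _ => pow_nonneg hx.le _) (fun _ _ => pow_nonneg hx.le _) fun P hP => ?_
  have hlen := mcPair_len hm hn hP
  rw [mul_assoc, ← pow_add, hlen, pow_succ, ← mul_assoc, mul_comm _ (hexCriticalFugacity ^ mwLen P),
    mul_assoc, inv_mul_cancel₀ hx.ne', mul_one]

/-! ## `L → ∞` and the main statement -/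

/-- `L → ∞`: a box inequality `α_{T,L,m+n-1} ≤ K β_{T,L,m} β_{T,2L,n}` for all `L` gives `α_{T,m+n-1} ≤ K β_{T,m} β_{T,n}`.
[cite: BeatonBousquetMelouDeGierDuminilCopinGuttmann2014, Corollary 8 (arXiv v5 p. 12: the coefficients α_{T,m}, β_{T,m})] -/
theorem stripAcoeff_contactCut_of_box (hT : 1 ≤ T) {K : ℝ} (hK : 0 ≤ K) {m n : ℕ}
    (hbox : ∀ L : ℕ, stripAcoeffY T L (m + n - 1) ≤ K * stripBcoeffY T L m * stripBcoeffY T (2 * L) n) :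
    stripAcoeff T (m + n - 1) ≤ K * stripBcoeff T m * stripBcoeff T n := by
  refine le_of_tendsto' (tendsto_stripAcoeffY hT (m + n - 1)) fun L => (hbox L).trans ?_
  have h1 := stripBcoeffY_le_stripBcoeff hT L m
  have h2 := stripBcoeffY_le_stripBcoeff hT (2 * L) n
  have := mul_le_mul h1 h2 (stripBcoeffY_nonneg T (2 * L) n) (stripBcoeff_nonneg hT m)
  calc K * stripBcoeffY T L m * stripBcoeffY T (2 * L) n
      = K * (stripBcoeffY T L m * stripBcoeffY T (2 * L) n) := by ring
    _ ≤ K * (stripBcoeff T m * stripBcoeff T n) := mul_le_mul_of_nonneg_left this hK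
    _ = K * stripBcoeff T m * stripBcoeff T n := by ring

/-- **The contact-indexed arch cut** `α_{T,m+n-1} ≤ x_c⁻¹ · β_{T,m} · β_{T,n}` for every `T ≥ 1`, `m, n ≥ 1`, in the
binder shape `hC` of `HexSAWStripSurfaceThresholdBootstrap` (with `K = x_c⁻¹`).
[cite: BeatonBousquetMelouDeGierDuminilCopinGuttmann2014, §4.5 eq. (20) (arXiv v5 p. 15: an arch cut at a surface contact into two bridges); lane: the cut at the m-th contact inside one width] -/
theorem stripArchContactCut_holds (hT : 1 ≤ T) :
    ∃ K : ℝ, 0 < K ∧ ∀ m n : ℕ, 1 ≤ m → 1 ≤ n →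
      stripAcoeff T (m + n - 1) ≤ K * stripBcoeff T m * stripBcoeff T n :=
  ⟨hexCriticalFugacity⁻¹, inv_pos.2 hexCriticalFugacity_pos_lt_one.1, fun _ _ hm hn =>
    stripAcoeff_contactCut_of_box hT (inv_pos.2 hexCriticalFugacity_pos_lt_one.1).le fun L =>
      stripAcoeffY_contactCut hT L hm hn⟩

end

end Literature.Probability.RandomPlanarGeometry.SAW.HV
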